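import Literature.Geometry.Symplectic.WedgeGramSchmidtSmooth
import Literature.Geometry.Symplectic.SelfDualTripleFrameSmooth
import HarnessLib

/-!
# The adapted frame of a smooth family of definite gradients

Topic `Geometry/Symplectic`; namespace `Literature.Geometry.Symplectic`.  Theorems only; no named
fact, no `sorry`.  `NearSymplecticAdaptedFrame.exists_adaptedFrame_of_definiteImage` adapts a
frame of `ℝ⁴` to ONE linear map `G : ℝ⁴ → Λ²` of rank `3` with definite image and prescribed
kernel vector.  Here `G = J(θ)` varies `C^∞` with a parameter `θ` (the `1`-jet of a
near-symplectic form along a zero circle, in tube coordinates where the kernel is the constant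
axis direction `e₀`), and the frame `A(θ)`, the scale `c(θ)` and the wedge-orthonormal triple
`η_k(θ) ⊆ im J(θ)` are produced `C^∞` in `θ` and `T`-periodic whenever `J` is
(`exists_contDiff_adaptedFrame`): the frame satisfies `A(θ) e₀ = e₀`,
`η_k(θ)(A u, A v) = c(θ) β_k(u, v)` for the standard self-dual triple `β_k`, and every value of
`J(θ)` expands in the `η_k(θ)`; with `gradient_frame_apply` this is Perutz's expansion
`ω(t, x) = x · S(t) β + O(|x|²)` with `S` SMOOTH in `t` (Perutz 2006, §3, proof of Lemma 3.1,
step 1).  Ingredients: smooth wedge-Gram–Schmidt (`WedgeGramSchmidtSmooth.lean`) and the smooth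
quaternionic frame (`SelfDualTripleFrameSmooth.lean`).

## References

* T. Perutz, *Zero-sets of near-symplectic forms*, J. Symplectic Geom. 4 (2006), Lemma 2.1 (b)
  and §3. [Perutz2006]
-/

noncomputable section

open Set Function Module Literature.Geometry.Kaehler Literature.Topology.FourManifolds
open scoped ContDiff

namespace Literature.Geometry.Symplectic

/-- Expansion of a vector of `ℝ⁴` in the standard basis: `W = Σ Wᵢ eᵢ`. [folklore] -/
theorem eq_sum_smul_stdVec (W : EuclideanSpace ℝ (Fin 4)) : W = ∑ i, W i • stdVec i := by
  conv_lhs => rw [← (EuclideanSpace.basisFun (Fin 4) ℝ).sum_repr W]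
  simp [EuclideanSpace.basisFun_apply, stdVec]

/-- The coordinates `1, 2, 3` of `Σ_{i<3} aᵢ e_{i+1}` are the `aᵢ`, that of `e₀` vanish. [folklore] -/
theorem sum_smul_stdVec_succ_apply (a : Fin 3 → ℝ) (k : Fin 3) :
    (∑ i, a i • (stdVec i.succ : EuclideanSpace ℝ (Fin 4))) k.succ = a k := by
  fin_cases k <;> simp [Fin.sum_univ_three, stdVec]

/-- **The smooth adapted frame of a smooth family of definite gradients.**  Let
`J : ℝ → (ℝ⁴ →L Λ²(ℝ⁴)*)` be `C^∞` (in the sense that each `θ ↦ J(θ) W` is), with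
`J(θ) e₀ = 0`, `rank J(θ) = 3`, and `s Pf(J(θ) W) > 0` whenever `J(θ) W ≠ 0` (`s = ±1`).  Then
there are, `C^∞` in `θ`: frames `A(θ) ∈ GL(ℝ⁴)` with `A(θ) e₀ = e₀`, scales `c(θ) ≠ 0`, and
wedge-orthonormal triples `η_k(θ) ⊆ im J(θ)` of Pfaffian `s` with
`η_k(θ)(A(θ)u, A(θ)v) = c(θ) β_k(u, v)` and `J(θ) W = Σ_k (⟨J(θ)W, η_k(θ)⟩ / 2s) η_k(θ)`; all
are `T`-periodic if `J` is. [cite: Perutz2006, Lemma 2.1 (b) and §3 (proof of Lemma 3.1, step 1)] -/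
theorem exists_contDiff_adaptedFrame
    {J : ℝ → (EuclideanSpace ℝ (Fin 4) →L[ℝ] ((EuclideanSpace ℝ (Fin 4)) [⋀^Fin 2]→L[ℝ] ℝ))}
    (hJ : ∀ W, ContDiff ℝ ∞ fun θ ↦ J θ W) {s : ℝ} (hs : s = 1 ∨ s = -1)
    (hrank : ∀ θ, Module.finrank ℝ (LinearMap.range (J θ).toLinearMap) = 3)
    (hdef : ∀ θ W, J θ W ≠ 0 → 0 < s * pfaffian (J θ W)) (hJ0 : ∀ θ, J θ (stdVec 0) = 0) :
    ∃ (A : ℝ → (EuclideanSpace ℝ (Fin 4) ≃L[ℝ] EuclideanSpace ℝ (Fin 4))) (c : ℝ → ℝ)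
      (η : Fin 3 → ℝ → (EuclideanSpace ℝ (Fin 4)) [⋀^Fin 2]→L[ℝ] ℝ),
      (∀ u, ContDiff ℝ ∞ fun θ ↦ A θ u) ∧ ContDiff ℝ ∞ c ∧ (∀ k, ContDiff ℝ ∞ (η k)) ∧
      (∀ θ, c θ ≠ 0) ∧ (∀ θ, A θ (stdVec 0) = stdVec 0) ∧
      (∀ θ, IsWedgeOrthonormalTriple (η 0 θ) (η 1 θ) (η 2 θ) s) ∧
      (∀ θ k, η k θ ∈ LinearMap.range (J θ).toLinearMap) ∧
      (∀ θ u v, η 0 θ ![A θ u, A θ v] = c θ * hondaBeta₁ ![u, v]) ∧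
      (∀ θ u v, η 1 θ ![A θ u, A θ v] = c θ * hondaBeta₂ ![u, v]) ∧
      (∀ θ u v, η 2 θ ![A θ u, A θ v] = c θ * hondaBeta₃ ![u, v]) ∧
      (∀ θ W, J θ W = ∑ k, (pfaffianPair (J θ W) (η k θ) / (2 * s)) • η k θ) ∧
      ∀ T : ℝ, (∀ θ, J (θ + T) = J θ) →
        ∀ θ, A (θ + T) = A θ ∧ c (θ + T) = c θ ∧ ∀ k, η k (θ + T) = η k θ := by
  have hs0 : s ≠ 0 := by rcases hs with rfl | rfl <;> norm_num
  have he0 : (stdVec 0 : EuclideanSpace ℝ (Fin 4)) ≠ 0 := by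
    intro h; have := congrArg (· 0) h; simp [stdVec] at this
  -- (1) `ker J(θ) = ℝ e₀` by rank–nullity
  have hker : ∀ θ u, J θ u = 0 → ∃ a : ℝ, a • stdVec 0 = u := by
    intro θ u hu
    have hker1 : Module.finrank ℝ (LinearMap.ker (J θ).toLinearMap) = 1 := by
      have hrn := LinearMap.finrank_range_add_finrank_ker (J θ).toLinearMap
      rw [hrank θ, finrank_euclideanSpace_fin] at hrn
      omega
    have hτk : (⟨stdVec 0, LinearMap.mem_ker.2 (hJ0 θ)⟩ : LinearMap.ker (J θ).toLinearMap) ≠ 0 :=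
      fun h0 ↦ he0 (congrArg Subtype.val h0)
    obtain ⟨a, ha⟩ :=
      (finrank_eq_one_iff_of_nonzero' _ hτk).1 hker1 ⟨u, LinearMap.mem_ker.2 hu⟩
    exact ⟨a, congrArg Subtype.val ha⟩
  -- (2) the smooth independent definite triple `ζ_i(θ) = J(θ) e_{i+1}`
  set ζ : Fin 3 → ℝ → (EuclideanSpace ℝ (Fin 4)) [⋀^Fin 2]→L[ℝ] ℝ :=
    fun i θ ↦ J θ (stdVec i.succ) with hζ
  have hζs : ∀ i, ContDiff ℝ ∞ (ζ i) := fun i ↦ hJ _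
  have hζsum : ∀ θ (a : Fin 3 → ℝ), ∑ i, a i • ζ i θ = J θ (∑ i, a i • stdVec i.succ) := by
    intro θ a; simp only [hζ, map_sum, map_smul]
  have hdefζ : ∀ θ (a : Fin 3 → ℝ) (k : Fin 3), a k ≠ 0 →
      0 < s * pfaffian (∑ i, a i • ζ i θ) := by
    intro θ a k hk
    rw [hζsum]
    refine hdef θ _ fun h0 ↦ hk ?_
    obtain ⟨b, hb⟩ := hker θ _ h0
    have h1 := congrArg (fun W : EuclideanSpace ℝ (Fin 4) ↦ W k.succ) hb
    simp only [PiLp.smul_apply, smul_eq_mul, sum_smul_stdVec_succ_apply] at h1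
    have h2 : (stdVec 0 : EuclideanSpace ℝ (Fin 4)) k.succ = 0 := by
      simp [stdVec, Fin.succ_ne_zero]
    rw [h2, mul_zero] at h1
    exact h1.symm
  obtain ⟨η, hηs, hW, hmn, hper⟩ := exists_contDiff_wedgeOrthonormalTriple hs hζs hdefζ
  have hPf : ∀ k θ, pfaffian (η k θ) ≠ 0 := by
    intro k θ
    have h := (hW θ).pfaffianPair_eq_ite (η := fun k ↦ η k θ) k k
    rw [if_pos rfl, pfaffianPair_self] at h
    have h' : pfaffian (η k θ) = s := by linarith
    rw [h']; exact hs0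
  -- (3) the quaternionic frame at `e₀`, smooth in `θ`
  have hinj : ∀ θ, Injective
      (IsWedgeOrthonormalTriple.frameMap (η 0 θ) (η 1 θ) (η 2 θ) (stdVec 0)) :=
    fun θ ↦ (hW θ).injective_frameMap he0
  set A : ℝ → (EuclideanSpace ℝ (Fin 4) ≃L[ℝ] EuclideanSpace ℝ (Fin 4)) := fun θ ↦
    (LinearEquiv.ofInjectiveEndo _ (hinj θ)).toContinuousLinearEquiv with hAdef
  have hA : ∀ θ u, A θ u =
      ∑ i, u i • IsWedgeOrthonormalTriple.frame (η 0 θ) (η 1 θ) (η 2 θ) (stdVec 0) i := by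
    intro θ u
    change LinearEquiv.ofInjectiveEndo _ (hinj θ) u = _
    rw [LinearEquiv.coe_ofInjectiveEndo, IsWedgeOrthonormalTriple.frameMap_apply]
  set c : ℝ → ℝ := fun θ ↦
    IsWedgeOrthonormalTriple.frameCoeff (η 0 θ) (η 1 θ) (η 2 θ) (stdVec 0) with hcdef
  have hcs : ContDiff ℝ ∞ c :=
    contDiff_frameCoeff_comp (hηs 0) (hηs 1) (hηs 2) (hPf 2) (stdVec 0)
  have hc0 : ∀ θ, c θ ≠ 0 := fun θ ↦ (hW θ).frameCoeff_ne_zero he0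
  have hAs : ∀ u, ContDiff ℝ ∞ fun θ ↦ A θ u := by
    intro u
    have h : (fun θ ↦ A θ u) = fun θ ↦
        ∑ i, u i • IsWedgeOrthonormalTriple.frame (η 0 θ) (η 1 θ) (η 2 θ) (stdVec 0) i := by
      funext θ; exact hA θ u
    rw [h]
    exact contDiff_sum_smul_frame_comp (hηs 0) (hηs 1) (hηs 2) (hPf 0) (hPf 1) (hPf 2)
      (stdVec 0) (a := fun _ i ↦ u i) fun i ↦ contDiff_const
  have hA0 : ∀ θ, A θ (stdVec 0) = stdVec 0 := by
    intro θ
    rw [hA, ← IsWedgeOrthonormalTriple.frameMap_apply]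
    exact IsWedgeOrthonormalTriple.frameMap_stdVec_zero _
  -- the frame relations
  have h1 : ∀ θ u v, η 0 θ ![A θ u, A θ v] = c θ * hondaBeta₁ ![u, v] := by
    intro θ u v
    rw [hA, hA, (hW θ).alt₁_sum_frame, hondaBeta₁_apply]
  have h2 : ∀ θ u v, η 1 θ ![A θ u, A θ v] = c θ * hondaBeta₂ ![u, v] := by
    intro θ u v
    rw [hA, hA, (hW θ).alt₂_sum_frame, hondaBeta₂_apply]
  have h3 : ∀ θ u v, η 2 θ ![A θ u, A θ v] = c θ * hondaBeta₃ ![u, v] := by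
    intro θ u v
    rw [hA, hA, (hW θ).alt₃_sum_frame, hondaBeta₃_apply]
  -- (4) the triple lies in `im J(θ)`, and every value of `J(θ)` expands in it
  have hηV : ∀ θ k, η k θ ∈ LinearMap.range (J θ).toLinearMap := by
    intro θ k
    obtain ⟨m, n, hm, -⟩ := hmn θ
    exact ⟨∑ i, m k i • stdVec i.succ, ((hm k).trans (hζsum θ (m k))).symm⟩
  have hexp : ∀ θ W, J θ W = ∑ k, (pfaffianPair (J θ W) (η k θ) / (2 * s)) • η k θ := by
    intro θ W
    obtain ⟨m, n, -, hn⟩ := hmn θ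
    refine (hW θ).eq_sum_pfaffianPair_smul (a := fun k ↦ ∑ i, W i.succ * n i k) ?_
    calc J θ W = ∑ i : Fin 3, W i.succ • ζ i θ := by
          conv_lhs => rw [eq_sum_smul_stdVec W]
          rw [map_sum, Fin.sum_univ_succ]
          simp only [map_smul, hζ, hJ0, smul_zero, zero_add]
      _ = ∑ k, (∑ i, W i.succ * n i k) • η k θ := by
          simp only [hn, Finset.smul_sum, smul_smul, Finset.sum_smul]
          rw [Finset.sum_comm]
  refine ⟨A, c, η, hAs, hcs, hηs, hc0, hA0, hW, hηV, h1, h2, h3, hexp, ?_⟩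
  -- (5) periodicity
  intro T hJT θ
  have hζT : ∀ i θ, ζ i (θ + T) = ζ i θ := fun i θ ↦ by simp only [hζ, hJT]
  have hηT : ∀ k, η k (θ + T) = η k θ := fun k ↦ hper T hζT k θ
  refine ⟨?_, ?_, hηT⟩
  · refine ContinuousLinearEquiv.ext (funext fun u ↦ ?_)
    rw [hA, hA, hηT 0, hηT 1, hηT 2]
  · simp only [hcdef, hηT 0, hηT 1, hηT 2]

/-- **The gradient family in its adapted frames** (pointwise `gradient_frame_apply`): with
`A, c, η` from `exists_contDiff_adaptedFrame` and the SMOOTH coefficients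
`S_k(θ, W) = ⟨J(θ)(A(θ)W), η_k(θ)⟩ / 2s`,
`J(θ)(A(θ)W)(A(θ)U, A(θ)V) = c(θ) Σ_k S_k(θ, W) β_k(U, V)`; and `θ ↦ S_k(θ, W)` is `C^∞`.
[cite: Perutz2006, §3 (proof of Lemma 3.1, step 1)] -/
theorem contDiff_frameCoefficient
    {J : ℝ → (EuclideanSpace ℝ (Fin 4) →L[ℝ] ((EuclideanSpace ℝ (Fin 4)) [⋀^Fin 2]→L[ℝ] ℝ))}
    (hJ : ∀ W, ContDiff ℝ ∞ fun θ ↦ J θ W)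
    {A : ℝ → (EuclideanSpace ℝ (Fin 4) ≃L[ℝ] EuclideanSpace ℝ (Fin 4))}
    (hA : ∀ u, ContDiff ℝ ∞ fun θ ↦ A θ u)
    {η : ℝ → (EuclideanSpace ℝ (Fin 4)) [⋀^Fin 2]→L[ℝ] ℝ} (hη : ContDiff ℝ ∞ η) (s : ℝ)
    (W : EuclideanSpace ℝ (Fin 4)) :
    ContDiff ℝ ∞ fun θ ↦ pfaffianPair (J θ (A θ W)) (η θ) / (2 * s) := by
  refine (contDiff_pfaffianPair ?_ hη).div_const _
  -- `θ ↦ J θ (A θ W)`: expand `A θ W` in the standard basis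
  have h : (fun θ ↦ J θ (A θ W)) = fun θ ↦ ∑ i, (A θ W) i • J θ (stdVec i) := by
    funext θ
    conv_lhs => rw [eq_sum_smul_stdVec (A θ W)]
    simp only [map_sum, map_smul]
  rw [h]
  exact ContDiff.sum fun i _ ↦ (contDiff_euclidean.1 (hA W) i).smul (hJ _)

end Literature.Geometry.Symplectic

end
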